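import Literature.NumberTheory.Sieve.BombieriFriedlanderIwaniecTheorem7StarBlocks
import HarnessLib

/-!
# Bombieri–Friedlander–Iwaniec 1986, Theorem 7* (§14): the `q ↔ s` symmetry, counting part

Topic `Literature/NumberTheory/Sieve`, continuation of
`Literature.NumberTheory.Sieve.BombieriFriedlanderIwaniecTheorem7StarBlocks`.  Everything here is
PROVED; no named fact is introduced.

BFI remove the auxiliary condition `Q²R < x` of (14.4) "as in Theorem 6" (§14, p. 246), i.e. by the
symmetry of §13 (p. 241–242): "note that we are dealing with the equation `mn = a + qrs` with `m ∼ M`,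
`n ∼ N`, `Q < q ≤ Q₁`, `r ∼ R` where `MN = x ∼ QRs`.  Since both `q` and `s` are counted with weight 1
… they appear symmetrically in `𝒟` except that `s` runs through an interval dependent on `m, n, r`.
By a subdivision argument we remove this dependence with an admissible error term, since
`s ∼ S = x/QR > ℒ^B`, this lower bound being crucial to the argument.  Now, we have either `Q²R ≤ x`
or `S²R ≤ x`".  This file contains the exact counting identities behind the symmetry for the sums of
§14 (three variables `l, m, n`):

* `BFI.card_dvd_Ioc_eq_card_switch` — for `K ≥ 1`: `#{q ∈ (Q', 2Q'] : q ∣ K} = #{s ∣ K : Q's < K ≤ 2Q's}`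
  (the bijection `q ↦ K/q`).
* `BFI.sum_Ioc_dvd_indicator_eq` — the same in the form used inside the congruence counts: for `K ≥ 1`,
  `r ≥ 1` and any `S ≥ K`,
  `∑_{q ∈ (Q',2Q']} 1_{qr ∣ K·?}` … precisely
  `∑_{q ∈ (Q', 2Q']} 1_{(qr : ℤ) ∣ K} = ∑_{s ≤ S} 1_{(rs : ℤ) ∣ K ∧ Q'rs < K ≤ 2Q'rs}` for an integer `K ≥ 1`.

The strip condition `Q'rs < lmn − a ≤ 2Q'rs` couples `s` with `l, m, n, r`; its removal by
subdivision, the main-term matching (a difference of logarithms of the sums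
`∑_{n ≤ T, (n,k)=1} 1/φ(nr)`), and the assembly are not in this file.

## References

* E. Bombieri, J. B. Friedlander, H. Iwaniec, *Primes in arithmetic progressions to large moduli*,
  Acta Math. 156 (1986), 203–251: §13 p. 241–242; §14 p. 246. [BombieriFriedlanderIwaniecActa1986]
-/

open Finset Real
open scoped ArithmeticFunction.sigma

namespace Literature.NumberTheory.Sieve

namespace BFI

/-! ### The bijection `q ↦ K/q` -/

/-- **The `q ↔ s` symmetry, exact form**: for `K ≥ 1`, the divisors `q` of `K` in `(Q', 2Q']` are in
bijection with the divisors `s = K/q` of `K` satisfying `Q's < K ≤ 2Q's`.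
[cite: BombieriFriedlanderIwaniecActa1986, §13 p. 241–242] -/
theorem card_dvd_Ioc_eq_card_switch {K : ℕ} (hK : K ≠ 0) (Q' : ℕ) :
    ((Ioc Q' (2 * Q')).filter (fun q : ℕ => q ∣ K)).card =
      (K.divisors.filter (fun s : ℕ => Q' * s < K ∧ K ≤ 2 * Q' * s)).card := by
  refine Finset.card_bij (fun q _ => K / q) (fun q hq => ?_) (fun q₁ hq₁ q₂ hq₂ h => ?_) (fun s hs => ?_)
  · -- maps into
    rw [Finset.mem_filter, Finset.mem_Ioc] at hq
    obtain ⟨⟨hq1, hq2⟩, ⟨t, ht⟩⟩ := hq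
    have hq0 : 0 < q := by omega
    have hKq : K / q = t := by rw [ht, Nat.mul_div_cancel_left t hq0]
    rw [Finset.mem_filter, Nat.mem_divisors, hKq]
    refine ⟨⟨⟨q, by rw [ht, mul_comm]⟩, hK⟩, ?_, ?_⟩
    · calc Q' * t < q * t := Nat.mul_lt_mul_of_pos_right hq1 (Nat.pos_of_ne_zero (by rintro rfl; simp [ht] at hK))
        _ = K := by rw [ht]
    · calc K = q * t := ht
        _ ≤ 2 * Q' * t := Nat.mul_le_mul_right t hq2
  · -- injective
    rw [Finset.mem_filter] at hq₁ hq₂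
    obtain ⟨t₁, ht₁⟩ := hq₁.2
    obtain ⟨t₂, ht₂⟩ := hq₂.2
    have h1 : 0 < q₁ := by have := (Finset.mem_Ioc.1 hq₁.1).1; omega
    have h2 : 0 < q₂ := by have := (Finset.mem_Ioc.1 hq₂.1).1; omega
    have e1 : K / q₁ = t₁ := by rw [ht₁, Nat.mul_div_cancel_left t₁ h1]
    have e2 : K / q₂ = t₂ := by rw [ht₂, Nat.mul_div_cancel_left t₂ h2]
    simp only [e1, e2] at h
    have ht0 : 0 < t₁ := Nat.pos_of_ne_zero (by rintro rfl; simp [ht₁] at hK)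
    apply Nat.eq_of_mul_eq_mul_right ht0
    rw [← ht₁, h, ← ht₂]
  · -- surjective
    rw [Finset.mem_filter, Nat.mem_divisors] at hs
    obtain ⟨⟨⟨q, hq⟩, -⟩, hs1, hs2⟩ := hs
    have hs0 : 0 < s := Nat.pos_of_ne_zero (by rintro rfl; simp [hq] at hK)
    refine ⟨q, ?_, ?_⟩
    · rw [Finset.mem_filter, Finset.mem_Ioc]
      refine ⟨⟨?_, ?_⟩, ⟨s, by rw [hq, mul_comm]⟩⟩
      · by_contra h
        push Not at h
        have : K ≤ Q' * s := by
          rw [hq, mul_comm s q]; exact Nat.mul_le_mul_right s h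
        omega
      · by_contra h
        push Not at h
        have : 2 * Q' * s < K := by
          calc 2 * Q' * s = s * (2 * Q') := by ring
            _ < s * q := Nat.mul_lt_mul_of_pos_left h hs0
            _ = K := hq.symm
        omega
    · show K / q = s
      have hq0 : 0 < q := Nat.pos_of_ne_zero (by rintro rfl; simp [hq] at hK)
      rw [hq, Nat.mul_div_cancel s hq0]

/-- The switch inside a congruence count: for an integer `K ≥ 1`, `r ≥ 1`, and any `S` with `K ≤ S`,
`∑_{q ∈ (Q', 2Q']} 1_{(qr) ∣ K} = ∑_{s ≤ S} 1_{(rs) ∣ K ∧ Q'rs < K ≤ 2Q'rs}`.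
[cite: BombieriFriedlanderIwaniecActa1986, §13 p. 241–242] -/
theorem sum_Ioc_dvd_indicator_eq {K : ℤ} (hK : 0 < K) {r : ℕ} (hr : 0 < r) (Q' : ℕ) {S : ℕ}
    (hS : K ≤ S) :
    ∑ q ∈ Ioc Q' (2 * Q'), (if ((q * r : ℕ) : ℤ) ∣ K then (1 : ℝ) else 0) =
      ∑ s ∈ Icc 1 S, (if ((r * s : ℕ) : ℤ) ∣ K ∧ (Q' : ℤ) * r * s < K ∧ K ≤ 2 * (Q' : ℤ) * r * s
        then (1 : ℝ) else 0) := by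
  -- both sides are cardinalities
  rw [← Finset.sum_filter, ← Finset.sum_filter, Finset.sum_const, Finset.sum_const, nsmul_eq_mul,
    nsmul_eq_mul, mul_one, mul_one]
  congr 1
  -- `K = r K₁` or both sides vanish
  lift K to ℕ using hK.le
  have hK0 : K ≠ 0 := by exact_mod_cast hK.ne'
  by_cases hrK : r ∣ K
  · obtain ⟨K₁, rfl⟩ := hrK
    have hK₁ : K₁ ≠ 0 := by rintro rfl; simp at hK0
    -- left side: `qr ∣ rK₁ ↔ q ∣ K₁`
    have hL : (Ioc Q' (2 * Q')).filter (fun q : ℕ => ((q * r : ℕ) : ℤ) ∣ ((r * K₁ : ℕ) : ℤ)) =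
        (Ioc Q' (2 * Q')).filter (fun q : ℕ => q ∣ K₁) := by
      refine Finset.filter_congr fun q _ => ?_
      rw [Int.natCast_dvd_natCast, mul_comm q r]
      exact Nat.mul_dvd_mul_iff_left hr
    -- right side: the divisors `s` of `K₁` with the strip condition
    have hR : (Icc 1 S).filter (fun s : ℕ => ((r * s : ℕ) : ℤ) ∣ ((r * K₁ : ℕ) : ℤ) ∧
          (Q' : ℤ) * r * s < ((r * K₁ : ℕ) : ℤ) ∧ ((r * K₁ : ℕ) : ℤ) ≤ 2 * (Q' : ℤ) * r * s) =
        K₁.divisors.filter (fun s : ℕ => Q' * s < K₁ ∧ K₁ ≤ 2 * Q' * s) := by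
      ext s
      simp only [Finset.mem_filter, Finset.mem_Icc, Nat.mem_divisors]
      rw [Int.natCast_dvd_natCast]
      have hr' : (0 : ℤ) < r := by exact_mod_cast hr
      constructor
      · rintro ⟨⟨hs1, -⟩, hdvd, h1, h2⟩
        refine ⟨⟨(Nat.mul_dvd_mul_iff_left hr).1 hdvd, hK₁⟩, ?_, ?_⟩
        · have : (Q' : ℤ) * s < K₁ := by
            have h1' : (r : ℤ) * (Q' * s) < r * K₁ := by push_cast at h1; linarith
            exact lt_of_mul_lt_mul_left h1' hr'.le
          exact_mod_cast this
        · have : (K₁ : ℤ) ≤ 2 * Q' * s := by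
            have h2' : (r : ℤ) * K₁ ≤ r * (2 * Q' * s) := by push_cast at h2; linarith
            exact le_of_mul_le_mul_left h2' hr'
          exact_mod_cast this
      · rintro ⟨⟨hdvd, -⟩, h1, h2⟩
        have hs0 : 0 < s := Nat.pos_of_ne_zero (by rintro rfl; simp at h2; exact hK₁ h2)
        refine ⟨⟨hs0, ?_⟩, (Nat.mul_dvd_mul_iff_left hr).2 hdvd, ?_, ?_⟩
        · have hsK : s ≤ K₁ := Nat.le_of_dvd (Nat.pos_of_ne_zero hK₁) hdvd
          have : (K₁ : ℤ) ≤ r * K₁ := by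
            have : (1 : ℤ) ≤ r := by exact_mod_cast hr
            nlinarith
          have hS' : ((r * K₁ : ℕ) : ℤ) ≤ S := hS
          push_cast at hS'
          exact_mod_cast (show (s : ℤ) ≤ S by have := (Nat.cast_le (α := ℤ)).2 hsK; linarith)
        · have h1' : (Q' : ℤ) * s < K₁ := by exact_mod_cast h1
          push_cast; nlinarith
        · have h2' : (K₁ : ℤ) ≤ 2 * Q' * s := by exact_mod_cast h2
          push_cast; nlinarith
    rw [hL, hR]
    exact card_dvd_Ioc_eq_card_switch hK₁ Q'
  · -- `r ∤ K`: both sides are empty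
    have hL : (Ioc Q' (2 * Q')).filter (fun q : ℕ => ((q * r : ℕ) : ℤ) ∣ (K : ℤ)) = ∅ := by
      refine Finset.filter_eq_empty_iff.2 fun q _ h => hrK ?_
      rw [Int.natCast_dvd_natCast] at h
      exact Nat.dvd_trans (Nat.dvd_mul_left r q) h
    have hR : (Icc 1 S).filter (fun s : ℕ => ((r * s : ℕ) : ℤ) ∣ (K : ℤ) ∧
        (Q' : ℤ) * r * s < (K : ℤ) ∧ (K : ℤ) ≤ 2 * (Q' : ℤ) * r * s) = ∅ := by
      refine Finset.filter_eq_empty_iff.2 fun s _ h => hrK ?_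
      have h' := h.1
      rw [Int.natCast_dvd_natCast] at h'
      exact Nat.dvd_trans (Nat.dvd_mul_right r s) h'
    rw [hL, hR]

/-! ### The switched congruence count of a block -/

/-- **The switched congruence count**: for the modulus `rs` and the dyadic range `q ∈ (Q', 2Q']` of
the complementary divisor, the weighted number of `(m, n)` in the block with
`lmn ≡ a (mod rs)` and `Q'rs < lmn − a ≤ 2Q'rs` (i.e. `(lmn − a)/(rs) ∈ (Q', 2Q']`).
[cite: BombieriFriedlanderIwaniecActa1986, §13 p. 241–242] -/
noncomputable def switchCongrCount (a : ℤ) (z : ℝ) (SM SN : Finset ℕ) (l r s Q' : ℕ) : ℝ :=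
  ∑ m ∈ SM, ∑ n ∈ SN,
    if ((r * s : ℕ) : ℤ) ∣ ((l * m * n : ℕ) : ℤ) - a ∧ (Q' : ℤ) * r * s < ((l * m * n : ℕ) : ℤ) - a ∧
        ((l * m * n : ℕ) : ℤ) - a ≤ 2 * (Q' : ℤ) * r * s
    then roughIndicator z m * roughIndicator z n else 0

/-- `lmn ≡ a (mod d)` as a divisibility. [folklore] -/
theorem natCast_zmod_eq_iff_dvd (a : ℤ) (k d : ℕ) :
    ((k : ℕ) : ZMod d) = (a : ZMod d) ↔ (d : ℤ) ∣ (k : ℤ) - a := by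
  rw [show ((k : ℕ) : ZMod d) = ((k : ℤ) : ZMod d) by rw [Int.cast_natCast],
    ZMod.intCast_eq_intCast_iff_dvd_sub]
  constructor
  · intro h; have := h.neg_right; rwa [neg_sub] at this
  · intro h; have := h.neg_right; rwa [neg_sub] at this

/-- **`A = A^{sw}` for a block** (the congruence counts summed over the dyadic range of `q` equal the
switched counts summed over `s`): if `lmn > a` and `lmn − a ≤ S` throughout the block, then for `r ≥ 1`
`∑_{q ∈ (Q', 2Q']} #ρρ{(m,n) : lmn ≡ a (qr)} = ∑_{s ≤ S} #ρρ{(m,n) : lmn ≡ a (rs), Q'rs < lmn − a ≤ 2Q'rs}`.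
(No coprimality condition on `q` is needed here: in `Δ*` the terms with `(q, al) > 1` have no
solutions.) [cite: BombieriFriedlanderIwaniecActa1986, §13 p. 241–242] -/
theorem sum_Ioc_setCongrCount_eq_switch (a : ℤ) (z : ℝ) {SM SN : Finset ℕ} {l r : ℕ} (hr : 0 < r)
    (Q' : ℕ) {S : ℕ} (hpos : ∀ m ∈ SM, ∀ n ∈ SN, a < ((l * m * n : ℕ) : ℤ))
    (hS : ∀ m ∈ SM, ∀ n ∈ SN, ((l * m * n : ℕ) : ℤ) - a ≤ S) :
    ∑ q ∈ Ioc Q' (2 * Q'), setCongrCount a z SM SN l (q * r) =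
      ∑ s ∈ Icc 1 S, switchCongrCount a z SM SN l r s Q' := by
  unfold setCongrCount switchCongrCount
  -- put the `q`- and `s`-sums inside
  rw [Finset.sum_comm]
  conv_rhs => rw [Finset.sum_comm]
  refine Finset.sum_congr rfl fun m hm => ?_
  rw [Finset.sum_comm]
  conv_rhs => rw [Finset.sum_comm]
  refine Finset.sum_congr rfl fun n hn => ?_
  -- for fixed `(m, n)`: factor the weight and switch
  set K : ℤ := ((l * m * n : ℕ) : ℤ) - a with hK
  have hK0 : 0 < K := by rw [hK]; linarith [hpos m hm n hn]
  have h1 : ∑ q ∈ Ioc Q' (2 * Q'),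
      (if ((l * m * n : ℕ) : ZMod (q * r)) = (a : ZMod (q * r)) then roughIndicator z m * roughIndicator z n else 0) =
      (roughIndicator z m * roughIndicator z n) *
        ∑ q ∈ Ioc Q' (2 * Q'), (if ((q * r : ℕ) : ℤ) ∣ K then (1 : ℝ) else 0) := by
    rw [Finset.mul_sum]
    refine Finset.sum_congr rfl fun q _ => ?_
    by_cases hc : ((l * m * n : ℕ) : ZMod (q * r)) = (a : ZMod (q * r))
    · rw [if_pos hc, if_pos ((natCast_zmod_eq_iff_dvd a _ _).1 hc), mul_one]
    · rw [if_neg hc, if_neg (fun h => hc ((natCast_zmod_eq_iff_dvd a _ _).2 h)), mul_zero]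
  have h2 : ∑ s ∈ Icc 1 S,
      (if ((r * s : ℕ) : ℤ) ∣ ((l * m * n : ℕ) : ℤ) - a ∧ (Q' : ℤ) * r * s < ((l * m * n : ℕ) : ℤ) - a ∧
          ((l * m * n : ℕ) : ℤ) - a ≤ 2 * (Q' : ℤ) * r * s
        then roughIndicator z m * roughIndicator z n else 0) =
      (roughIndicator z m * roughIndicator z n) *
        ∑ s ∈ Icc 1 S, (if ((r * s : ℕ) : ℤ) ∣ K ∧ (Q' : ℤ) * r * s < K ∧ K ≤ 2 * (Q' : ℤ) * r * s
          then (1 : ℝ) else 0) := by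
    rw [Finset.mul_sum]
    refine Finset.sum_congr rfl fun s _ => ?_
    split_ifs <;> simp
  rw [h1, h2, sum_Ioc_dvd_indicator_eq hK0 hr Q' (hS m hm n hn)]


end BFI

end Literature.NumberTheory.Sieve
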